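import Summits.Parity.GeneralizedHardyLittlewood.Theorems.LiouvilleShiftedTablesEngineToPairsDefs
import Summits.Parity.GeneralizedHardyLittlewood.Theorems.LiouvilleShiftedTablesBVLiouville
import Summits.Parity.GeneralizedHardyLittlewood.Theorems.LiouvilleShiftedTablesEngineToPairsTAvgOfParts
import Summits.Parity.GeneralizedHardyLittlewood.Theorems.LiouvilleShiftedTablesEngineToPairsTI2OfX2
import Summits.Parity.GeneralizedHardyLittlewood.Theorems.LiouvilleShiftedTablesEngineToPairsTIOfBVPart2
import Summits.Parity.GeneralizedHardyLittlewood.Theorems.LiouvilleShiftedTablesPairsFromMAvg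
import Summits.Parity.GeneralizedHardyLittlewood.Theorems.LiouvilleShiftedTablesEngineToPairsMAvgOfTAvg

/-!
# Skeleton of line `Sketch` for the crux `EngineToPairs` (stmt-Parity-14659) — line lead's work file

Crux: `Summit.Parity.GeneralizedHardyLittlewood.Theses.LiouvilleShiftedTables.EngineToPairs`
= `DilatedTableChowla → TypeI2Dilated → ElliottHalberstam → PairsHL` (fixed-shift Hardy–Littlewood pairs,
inlined).  Vocabulary: `Theorems/LiouvilleShiftedTablesEngineToPairsDefs.lean` (namespace
`Summit.Parity.GeneralizedHardyLittlewood.Theorems.EngineToPairs`).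

Stubs (sorries ONLY here; each is proved in its own `Theorems/LiouvilleShiftedTablesEngineToPairs<Stub>.lean`):

* `stub_pairsFromMAvg : PairsFromMAvg` — the EH half in Bombieri's arrangement (= support item
  stmt-Parity-14275; external prover active, parts 1–6 landed as `Theorems.PairsFromMAvg.*`);
* `stub_MAvg_of_TAvg : TAvg → MAvg` — the `k²`-trick `μ(d) = λ(d) ∑_{k²∣d} μ(k)`, `λ(d) = λ(m)λ(dm)`,
  single height `x + h`, `K = (log x)⁴`;
* `stub_TAvg_of_parts : CorrelationSieveFamily → TIBudget → TIIBudget → TI2Budget → TAvg` — parameter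
  choice `δ = min(ρ/3, 1/100)`, `ε₁ = δ/8`, `ε = δ/16`; dyadic scales `y/2^j ≥ √x`; classes `(q,h) > 1`
  hold `O(h log y)` prime powers; small scales trivially;
* `stub_sieve : CorrelationSieveFamily` — the load-bearing weight-agnostic inequality (lead's stub);
* `stub_TI_of_BV : BVLiouville → TIBudget`, `stub_TII_of_X1 : DilatedTableChowla → TIIBudget`,
  `stub_TI2_of_X2 : TypeI2Dilated → TI2Budget` — the three leaf instantiations.

Composition `EngineToPairs_of` is pure application (with `BVLiouville` PROVED in tree:
`Cruxes.TypeI2Dilated.PeelToDrappeau.stub_bvLiouville`; `ElliottHalberstam ↔ EH` is `Iff.rfl`).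
-/

namespace Summit.Parity.GeneralizedHardyLittlewood.Theorems.EngineToPairs

open Summit.Parity.GeneralizedHardyLittlewood.Theses.LiouvilleShiftedTables

/-- Stub S1 (item stmt-Parity-14275 verbatim): Bombieri's level-1 asymptotic sieve for `a_n = Λ(n+h)`:
`EH → MAvg → PairsHL` — PROVED in tree by the external prover of item 14275
(`Summit.Parity.GeneralizedHardyLittlewood.Theorems.PairsFromMAvg_proof`). -/
theorem stub_pairsFromMAvg : PairsFromMAvg :=
  Summit.Parity.GeneralizedHardyLittlewood.Theorems.PairsFromMAvg_proof

-- Stub S2 `stub_MAvg_of_TAvg : TAvg → MAvg`: LANDED (worker w-S2, p90695) as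
-- `Theorems/LiouvilleShiftedTablesEngineToPairsMAvgOfTAvg.lean`, imported above.

-- Stub S3 `stub_TAvg_of_parts : CorrelationSieveFamily → TIBudget → TIIBudget → TI2Budget → TAvg`:
-- LANDED (worker w-S3, p89157) as `Theorems/LiouvilleShiftedTablesEngineToPairsTAvgOfParts.lean`, imported above.

/-- Stub S4 (load-bearing, lead): the weight-agnostic correlation sieve in family form. -/
theorem stub_sieve : CorrelationSieveFamily := by
  sorry

-- Stub S5 `stub_TI_of_BV : BVLiouville → TIBudget`: LANDED (worker w-S5, p90633) as
-- `Theorems/LiouvilleShiftedTablesEngineToPairsTIOfBVPart2.lean`, imported above.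

/-- Stub S6: Type-II budget from the class-block fourth moment `DilatedTableChowla` (X1). -/
theorem stub_TII_of_X1 : DilatedTableChowla → TIIBudget := by
  sorry

-- Stub S7 `stub_TI2_of_X2 : TypeI2Dilated → TI2Budget`: LANDED (worker w-S7, p89758) as
-- `Theorems/LiouvilleShiftedTablesEngineToPairsTI2OfX2.lean`, imported above.

/-- **Composition**: the seven stubs close the crux `EngineToPairs` BY NAME (pure application;
`BVLiouville` is the tree theorem `stub_bvLiouville`; `ElliottHalberstam` and `EH` are definitionally equal). -/
theorem EngineToPairs_of : EngineToPairs := fun hD hI hE =>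
  stub_pairsFromMAvg hE
    (stub_MAvg_of_TAvg
      (stub_TAvg_of_parts stub_sieve
        (stub_TI_of_BV Cruxes.TypeI2Dilated.PeelToDrappeau.stub_bvLiouville)
        (stub_TII_of_X1 hD) (stub_TI2_of_X2 hI)))

end Summit.Parity.GeneralizedHardyLittlewood.Theorems.EngineToPairs
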